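import Summits.BirchSwinnertonDyer.BirchSwinnertonDyer.Theorems.CMKolyvaginAtInertTwoPairCurrencyAtTwo
import HarnessLib

/-!
# Route `CMKolyvaginAtInertTwo`, crux `CMKolyvaginExactAtInertTwo` (stmt-BirchSwinnertonDyer-24277):
# THE EIGEN-PAIR CURRENCY AT `p = 2`, II: THE SPLIT DESCENT DATA — an INSTANCE of
# `KolyvaginDescent.SplitDataM` from a Kolyvagin point system (ty2's `KolyvaginMachine.PointSystem`,
# prime `2`, level `2^M`) on `V = H¹(K, E[2^M])^{ε} × H¹(K, E[2^M])^{−ε}`, and its `Δ`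

Seat `bsd-line-cmk2-p1` g13 (cell `bsd-print-cf2`); helper (`--supports stmt-BirchSwinnertonDyer-24277`).
No named fact, no `sorry`; ONE definition (`pairData`, the instance) with its unfolding lemmas; no item
is closed; BSD is not proved by this.

WHY. The adaptive split-form Cassels–Tate telescope (`KolyvaginAdaptiveData.card_mul_card_le_of_
casselsTate_adaptive`, this seat) is a theorem about an abstract `S : SplitDataM V Pl` (the data
carrier without the Čebotarev / duality axioms, `Literature.….HeegnerPointsKolyvaginSplitDescentData`).
For it to bear on the crux one needs an INSTANCE at `p = 2`. The tree's `p = 2` kernel (seats g3–g12)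
lives over `K` in `H¹(K, E[2^M])` (`galH1Torsion`, `selmerGroup`, `conjAct`, `kolyvaginClass`, the
Čebotarev leaves), and its arithmetic input is ty2's DATUM `PointSystem N W K P 2 S M hdiv c` (Gross
(4.4), Props. 5.3, 6.2 = McCallum Lemma 4.3, Prop. 4.4, with the prime free; discharged on H₂ modulo
print by g9's `CMPointSystemTwo.nonempty_pointSystemFamily_two_of_cmInert_of_printedInputs`). Over `K`
the `τ`-eigengroups of `H¹(K, E[2^M])` do NOT meet trivially at `2`; Kolyvagin's frame at `l = 2`
(Izv. 1989 §3: the pair `(E, E^{d_K})` over `ℚ`) is, by inflation–restriction (`E(K)[2] = 0`), the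
EXTERNAL product of the two eigengroups. So:

* `eigK W c M ν` — the `ν`-eigengroup `{g : c_* g = ν g} ≤ H¹(K, E[2^M])`;
* `pairData` — for a point system `D` at `(2, M)` (support `S`), a point `x₀ ∈ E(K)` with
  `2^{M₀} x₀ = P` whose Kummer class is an `ε`-eigenclass, the `SplitDataM` on
  `V = ↥(eigK ε) × ↥(eigK (−ε))`, places `Pl = (finite places of K) ⊕ (infinite places)`:
  `eig (±ε)` the two factors; `Sel`, `Loc v`, `A ℓ` = the product of the traces of `Sel_{2^M}(E/K)`,
  of the local kernels `selmerLocalKer` at `v`, of the strict kernels `torsionLocalKer` at `λ = (ℓ)`;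
  `Kol ℓ` = "`ℓ` is a Kolyvagin prime of `(2, M)` in Gross's form with `S ℓ`"; `x = (δ x₀, 0)`;
  `c n` = Kolyvagin's class of `P_n` placed in the factor of its sign `ε(−1)^{r(n)}` (Gross Prop. 5.4
  (2), from `D.rel`); `c_mem_loc` = Prop. 6.2 (1) (+ nothing at the complex places);
  `c_mem_loc_iff` = Prop. 6.2 (2) (McCallum Prop. 4.4) ACROSS the factors; `x_ord` from `x₀ ∉ 2E(K)`
  (mod `2^M`), via the Kummer kernel;
* unfolding lemmas (`pairData_p`, `…_M`, `…_M₀`, `…_ε`, `mem_pairData_sel_iff`, `pairData_kol_iff`,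
  `mem_pairData_A_iff`, …) and the kernel `Δ` of `V → H¹(K, E[2^M])`, `(u, v) ↦ u + v`, with its
  purity (`pairDelta`, `mem_pairDelta_iff`, `eq_zero_of_mem_pairDelta_of_mem_eig` = the hypothesis
  `hΔpure` of the telescope).

What is NOT here: the telescope's analytic hypotheses for this instance (`hCTV` from ty2's
`ReciprocityFamily` + Cassels–Tate, `hCeb₂` from the Čebotarev leaf p669091 + the criterion p670347),
the lift groups, and the H₂-discharge of the hypotheses `hxε`, `hx` (g0/g7: no `2`-torsion, the
`M₀`-clause conversion). References: [GrossLMS1991] (4.4), Props. 5.3, 5.4 (2), 6.2; [McCallumLMS1991]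
Lemma 4.3, Prop. 4.4, Lemma 5.1; [Kolyvagin1989Izv] §3.
-/

-- single-conjunct summit: `Summit.BirchSwinnertonDyer.BirchSwinnertonDyer.…` repeats the name by design
set_option linter.dupNamespace false
set_option autoImplicit false

noncomputable section

open scoped Classical
open WeierstrassCurve NumberField IsDedekindDomain
open Literature.NumberTheory.GaloisRepresentations
open Literature.NumberTheory.EllipticCurves Literature.NumberTheory.EllipticCurves.KolyvaginDescent
open Summit.BirchSwinnertonDyer.Rank1Residual.P2.KolyvaginMachine

namespace Summit.BirchSwinnertonDyer.BirchSwinnertonDyer.Theorems.KolyvaginPairDataTwo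

variable {N : ℕ} (W : WeierstrassCurve ℚ) {K : Type} [Field K] [NumberField K]

section Instance

variable (c : K ≃ₐ[ℚ] K) (M : ℕ)
  (hdiv : ∀ Q : geomPoints (W.baseChange K), ∃ R, ((2 ^ M : ℕ) : ℤ) • R = Q)
  {S : ℕ → Prop} {P : (W.baseChange K).toAffine.Point}

/-- **THE SPLIT DESCENT DATA AT `p = 2` FROM A POINT SYSTEM** (eigen-pair currency). Inputs: a
Kolyvagin point system `D` at `(2, M)` for the conjugation `c` with support `S` (ty2's datum), the
`2^M`-divisibility of `E(K̄)`, `K` imaginary quadratic (nothing is asked at the complex places), a point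
`x₀ ∈ E(K)` with `2^{M₀} x₀ = P` (`P = y_K`; McCallum Lemma 5.1) whose Kummer class is an
`ε`-eigenclass (`hxε`) and with `2^{M−1} x₀ ∉ 2^M E(K)` (`hx`: `x₀ ∉ 2E(K)` when `E(K)[2] = 0`).
Output: the `SplitDataM` described in the module docstring. [cite: McCallumLMS1991, §§4–5 (Lemma 4.3, Prop. 4.4, Lemma 5.1)]
[cite: GrossLMS1991, (4.4), Props. 5.3, 5.4 (2), 6.2] [cite: Kolyvagin1989Izv, §3] -/
def pairData (hK : IsImaginaryQuadratic K) (D : PointSystem N W K P 2 S M hdiv c)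
    (x₀ : (W.baseChange K).toAffine.Point) (M₀ : ℕ) (hP : (((2 : ℕ) : ℤ) ^ M₀) • x₀ = P)
    (hxε : conjAct W c ((2 ^ M : ℕ) : ℤ) (kummerMapTorsion (W.baseChange K) _ hdiv x₀) =
      D.ε • kummerMapTorsion (W.baseChange K) _ hdiv x₀)
    (hx : ∀ Q : (W.baseChange K).toAffine.Point,
      ((2 ^ M : ℕ) : ℤ) • Q ≠ (((2 : ℕ) : ℤ) ^ (M - 1)) • x₀) :
    SplitDataM (PairV W c M D.ε) (Places K) where
  p := 2
  hp := Nat.prime_two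
  M := M
  torsion v := by
    have h2 : (((2 : ℕ) : ℤ) ^ M) = ((2 ^ M : ℕ) : ℤ) := by push_cast; ring
    refine Prod.ext (Subtype.ext ?_) (Subtype.ext ?_)
    · change ((((2 : ℕ) : ℤ) ^ M) • v.1 : ↥(eigK W c M D.ε)).1 = 0
      rw [AddSubgroupClass.coe_zsmul, h2]
      exact zsmul_galH1Torsion_eq_zero _ _ _
    · change ((((2 : ℕ) : ℤ) ^ M) • v.2 : ↥(eigK W c M (-D.ε))).1 = 0
      rw [AddSubgroupClass.coe_zsmul, h2]
      exact zsmul_galH1Torsion_eq_zero _ _ _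
  eig := pairEig W c M D.ε
  eig_disjoint v h₁ h₂ := by
    rcases D.hε with h | h
    · rw [show (1 : ℤ) = D.ε from h.symm, pairEig_self, AddSubgroup.mem_prod] at h₁
      rw [show (-1 : ℤ) = -D.ε by rw [h], pairEig_neg W c M D.hε, AddSubgroup.mem_prod] at h₂
      exact Prod.ext (AddSubgroup.mem_bot.mp h₂.1) (AddSubgroup.mem_bot.mp h₁.2)
    · rw [show (1 : ℤ) = -D.ε by rw [h]; decide, pairEig_neg W c M D.hε, AddSubgroup.mem_prod] at h₁
      rw [show (-1 : ℤ) = D.ε from h.symm, pairEig_self, AddSubgroup.mem_prod] at h₂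
      exact Prod.ext (AddSubgroup.mem_bot.mp h₁.1) (AddSubgroup.mem_bot.mp h₂.2)
  Sel := pairSel W c M D.ε
  sel_split s hs := by
    obtain ⟨hs1, hs2⟩ := AddSubgroup.mem_prod.mp hs
    have h10 : ((s.1, 0) : PairV W c M D.ε) ∈ pairSel W c M D.ε := AddSubgroup.mem_prod.mpr ⟨hs1, zero_mem _⟩
    have h02 : ((0, s.2) : PairV W c M D.ε) ∈ pairSel W c M D.ε := AddSubgroup.mem_prod.mpr ⟨zero_mem _, hs2⟩
    have hsum : s = (s.1, 0) + (0, s.2) := by rw [Prod.mk_add_mk, add_zero, zero_add]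
    rcases D.hε with h | h
    · refine ⟨(s.1, 0), (0, s.2), ⟨h10, ?_⟩, ⟨h02, ?_⟩, hsum⟩
      · rw [← h, pairEig_self]
        exact AddSubgroup.mem_prod.mpr ⟨AddSubgroup.mem_top _, zero_mem _⟩
      · rw [show (-1 : ℤ) = -D.ε by rw [h], pairEig_neg W c M D.hε]
        exact AddSubgroup.mem_prod.mpr ⟨zero_mem _, AddSubgroup.mem_top _⟩
    · refine ⟨(0, s.2), (s.1, 0), ⟨h02, ?_⟩, ⟨h10, ?_⟩, by rw [add_comm]; exact hsum⟩
      · rw [show (1 : ℤ) = -D.ε by rw [h]; decide, pairEig_neg W c M D.hε]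
        exact AddSubgroup.mem_prod.mpr ⟨zero_mem _, AddSubgroup.mem_top _⟩
      · rw [← h, pairEig_self]
        exact AddSubgroup.mem_prod.mpr ⟨AddSubgroup.mem_top _, zero_mem _⟩
  Loc := pairLoc W c M D.ε
  mem_sel_iff := mem_pairSel_iff W c M D.ε
  Kol ℓ := IsKolyvaginPrime N W K 2 ℓ ∧ FrobEqFrobInfty W K (2 ^ M) ℓ ∧ S ℓ
  prime_of_kol ℓ h := h.1.prime
  pl := pairPl (N := N) W
  Dv v n := Sum.elim (fun v : HeightOneSpectrum (𝓞 K) ↦ (n : 𝓞 K) ∈ v.asIdeal) (fun _ ↦ False) v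
  dv_iff ℓ hℓ v := by
    rcases v with v | w
    · change ((ℓ : 𝓞 K) ∈ v.asIdeal) ↔ _
      rw [pairPl, dif_pos hℓ.1, hℓ.1.mem_iff, Sum.inl.injEq]
    · change False ↔ _
      rw [pairPl, dif_pos hℓ.1]
      simp
  dv_mul ℓ ℓ' _ _ v := by
    rcases v with v | w
    · change (((ℓ * ℓ' : ℕ) : 𝓞 K) ∈ v.asIdeal) → ((ℓ : 𝓞 K) ∈ v.asIdeal) ∨ ((ℓ' : 𝓞 K) ∈ v.asIdeal)
      rw [Nat.cast_mul]
      exact v.isPrime.mem_or_mem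
    · exact fun h ↦ h.elim
  A := pairA (N := N) W c M D.ε
  x := pairX W c M hdiv x₀ hxε
  x_mem := AddSubgroup.mem_prod.mpr
    ⟨(mem_selmerGroup_iff _ _ _).mpr
      ⟨fun v ↦ kummerMapTorsion_mem_selmerLocalKer _ _ hdiv _ x₀,
        fun w ↦ kummerMapTorsion_mem_selmerLocalKer _ _ hdiv _ x₀⟩, zero_mem _⟩
  x_ord h := by
    have h1 := congrArg (fun v : PairV W c M D.ε ↦ (v.1 : galH1Torsion (W.baseChange K) ((2 ^ M : ℕ) : ℤ))) h
    have h2 : kummerMapTorsion (W.baseChange K) _ hdiv ((((2 : ℕ) : ℤ) ^ (M - 1)) • x₀) = 0 := by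
      rw [← (pairX_zsmul W c M hdiv x₀ hxε (M - 1)).1]
      exact h1
    have hker : (((2 : ℕ) : ℤ) ^ (M - 1)) • x₀ ∈ (kummerMapTorsion (W.baseChange K) _ hdiv).ker := h2
    rw [kummerMapTorsion_ker, AddMonoidHom.mem_range] at hker
    obtain ⟨Q, hQ⟩ := hker
    exact hx Q hQ
  M₀ := M₀
  ε := D.ε
  hε := D.hε
  x_eig := by
    rw [pairEig_self]
    exact AddSubgroup.mem_prod.mpr ⟨AddSubgroup.mem_top _, zero_mem _⟩
  c := pairC W c M hdiv D
  c_one := by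
    have h1 : KolSupp (fun ℓ ↦ IsKolyvaginPrime N W K 2 ℓ ∧ FrobEqFrobInfty W K (2 ^ M) ℓ ∧ S ℓ) 1 :=
      kolSupp_one _
    have he : Even (1 : ℕ).primeFactors.card := by simp
    have hc1 : cK W c M hdiv D 1 = kummerMapTorsion (W.baseChange K) _ hdiv P := by
      have hP1 : toGeomPoints (W.baseChange K) P ∈
          KolyvaginCocycle.invPoints (Field.absoluteGaloisGroup K) (D.A 1) ((2 ^ M : ℕ) : ℤ) := by
        rw [← D.Pt_one]; exact D.hPt 1
      rw [cK, KolyvaginDescent.kolyvaginClass_congr_point (D.hA 1) (hP' := hP1) D.Pt_one]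
      exact kolyvaginClass_toGeomPoints (D.hA 1) P hP1
    obtain ⟨hc, hz⟩ := pairC_of_even W c M hdiv D h1 he
    obtain ⟨hx1, hx2⟩ := pairX_zsmul W c M hdiv x₀ hxε M₀
    refine Prod.ext (Subtype.ext ?_) ?_
    · rw [hc, hx1, hP, hc1]
    · rw [hz, hx2]
  c_eig n hn := pairC_mem_pairEig W c M hdiv D hn
  c_mem_loc n hn v hv := pairC_mem_pairLoc W c M hdiv hK D hn v hv
  c_mem_loc_iff ℓ m hℓ hℓm a := pairC_mem_pairLoc_iff W c M hdiv D hℓ hℓm a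


/-! ## Unfolding the instance (all `rfl`) -/

section API

variable (hK : IsImaginaryQuadratic K) (D : PointSystem N W K P 2 S M hdiv c)
  (x₀ : (W.baseChange K).toAffine.Point) (M₀ : ℕ) (hP : (((2 : ℕ) : ℤ) ^ M₀) • x₀ = P)
  (hxε : conjAct W c ((2 ^ M : ℕ) : ℤ) (kummerMapTorsion (W.baseChange K) _ hdiv x₀) =
    D.ε • kummerMapTorsion (W.baseChange K) _ hdiv x₀)
  (hx : ∀ Q : (W.baseChange K).toAffine.Point, ((2 ^ M : ℕ) : ℤ) • Q ≠ (((2 : ℕ) : ℤ) ^ (M - 1)) • x₀)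

/-- The prime of the data is `2`. [folklore] -/
@[simp] theorem pairData_p : (pairData W c M hdiv hK D x₀ M₀ hP hxε hx).p = 2 := rfl

/-- The level of the data is `M`. [folklore] -/
@[simp] theorem pairData_M : (pairData W c M hdiv hK D x₀ M₀ hP hxε hx).M = M := rfl

/-- `M₀` of the data. [folklore] -/
@[simp] theorem pairData_M₀ : (pairData W c M hdiv hK D x₀ M₀ hP hxε hx).M₀ = M₀ := rfl

/-- The sign of the data is the point system's `ε`. [folklore] -/
@[simp] theorem pairData_ε : (pairData W c M hdiv hK D x₀ M₀ hP hxε hx).ε = D.ε := rfl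

/-- The eigengroups of the data. [folklore] -/
@[simp] theorem pairData_eig : (pairData W c M hdiv hK D x₀ M₀ hP hxε hx).eig = pairEig W c M D.ε := rfl

/-- The Selmer group of the data. [folklore] -/
@[simp] theorem pairData_Sel : (pairData W c M hdiv hK D x₀ M₀ hP hxε hx).Sel = pairSel W c M D.ε := rfl

/-- The local conditions of the data. [folklore] -/
@[simp] theorem pairData_Loc : (pairData W c M hdiv hK D x₀ M₀ hP hxε hx).Loc = pairLoc W c M D.ε := rfl

/-- The strict conditions of the data. [folklore] -/
@[simp] theorem pairData_A : (pairData W c M hdiv hK D x₀ M₀ hP hxε hx).A = pairA (N := N) W c M D.ε := rfl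

/-- The places of the Kolyvagin primes of the data. [folklore] -/
@[simp] theorem pairData_pl : (pairData W c M hdiv hK D x₀ M₀ hP hxε hx).pl = pairPl (N := N) W := rfl

/-- The Kolyvagin primes of the data: Gross-form Kolyvagin primes of `(2, M)` with `S ℓ`.
[cite: GrossLMS1991, §3 (3.1)–(3.3)] -/
theorem pairData_kol_iff (ℓ : ℕ) : (pairData W c M hdiv hK D x₀ M₀ hP hxε hx).Kol ℓ ↔
    IsKolyvaginPrime N W K 2 ℓ ∧ FrobEqFrobInfty W K (2 ^ M) ℓ ∧ S ℓ := Iff.rfl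

/-- The Heegner class of the data is `(δ x₀, 0)`. [folklore] -/
@[simp] theorem pairData_x : (pairData W c M hdiv hK D x₀ M₀ hP hxε hx).x = pairX W c M hdiv x₀ hxε := rfl

/-- Kolyvagin's classes of the data. [folklore] -/
@[simp] theorem pairData_c : (pairData W c M hdiv hK D x₀ M₀ hP hxε hx).c = pairC W c M hdiv D := rfl

end API

/-! ## The kernel `Δ` of `V → H¹(K, E[2^M])` and its purity (the telescope's `hΔpure`) -/

/-- `Δ = ker (V → H¹(K, E[2^M]), (u, v) ↦ u + v)` — at `2` the two eigengroups meet in the `c_*`-fixed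
`2`-torsion classes, and `Δ = {(u, −u)}` records it (the `Δ_H` of the memo
`MEMO-T5-adaptive-splitting` §1.4). [cite: Kolyvagin1989Izv, §3] -/
def pairDelta (ε : ℤ) : AddSubgroup (PairV W c M ε) :=
  ((eigK W c M ε).subtype.coprod (eigK W c M (-ε)).subtype).ker

/-- Membership in `Δ`: `u + v = 0` in `H¹(K, E[2^M])`. [folklore] -/
theorem mem_pairDelta_iff (ε : ℤ) (d : PairV W c M ε) :
    d ∈ pairDelta W c M ε ↔
      (d.1 : galH1Torsion (W.baseChange K) ((2 ^ M : ℕ) : ℤ)) + (d.2 : galH1Torsion (W.baseChange K)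
        ((2 ^ M : ℕ) : ℤ)) = 0 := by
  rw [pairDelta, AddMonoidHom.mem_ker, AddMonoidHom.coprod_apply, AddSubgroup.coe_subtype,
    AddSubgroup.coe_subtype]

/-- **`Δ` meets both eigengroups trivially** (the hypothesis `hΔpure` of
`KolyvaginAdaptiveData.card_mul_card_le_of_casselsTate_adaptive` for the instance `pairData`).
[cite: Kolyvagin1989Izv, §3] -/
theorem eq_zero_of_mem_pairDelta_of_mem_pairEig {ε : ℤ} (hε : ε = 1 ∨ ε = -1) (d : PairV W c M ε)
    (hd : d ∈ pairDelta W c M ε) (e : ℤ) (hde : d ∈ pairEig W c M ε e) : d = 0 := by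
  rw [mem_pairDelta_iff] at hd
  by_cases h1 : e = ε
  · rw [h1, pairEig_self, AddSubgroup.mem_prod] at hde
    have h2 : d.2 = 0 := AddSubgroup.mem_bot.mp hde.2
    rw [h2, ZeroMemClass.coe_zero, add_zero] at hd
    exact Prod.ext (Subtype.ext hd) h2
  by_cases h2 : e = -ε
  · rw [h2, pairEig_neg W c M hε, AddSubgroup.mem_prod] at hde
    have h3 : d.1 = 0 := AddSubgroup.mem_bot.mp hde.1
    rw [h3, ZeroMemClass.coe_zero, zero_add] at hd
    exact Prod.ext h3 (Subtype.ext hd)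
  · rw [pairEig, if_neg h1, if_neg h2] at hde
    exact AddSubgroup.mem_bot.mp hde

end Instance

end Summit.BirchSwinnertonDyer.BirchSwinnertonDyer.Theorems.KolyvaginPairDataTwo
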